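import Literature.NumberTheory.ConnesConsani2021.QuasiInnerProductOrder
import Literature.NumberTheory.ConnesConsani2021.QuasiInnerGaussFactors
import HarnessLib

/-!
# Connes–Consani 2021 (JNT) §4.4, Theorem 4.8 — the operator algebra of the proof: products of
# quasi-inner symbols with off-diagonal parts of order `α`, and the reduction of Theorem 4.8 to its
# factors `ρ_∞^{(m,k)}ρ_p`

LINE 1 — LABEL: RH-FREE corpus literature (operator algebra of «triangular modulo compact» multiplication
operators on `L²(S¹)`; no positivity statement, no statement about zeros of `ζ`); bears_on: W-C/W-P (P5
sequel vocabulary, no leaf role); WHAT THIS IS NOT: any claim about RH — nothing in this file bears on the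
truth of RH.

Source: A. Connes, C. Consani, *Quasi-inner functions and local factors*, J. Number Theory **226**
(2021) 139–167 = arXiv:2008.10974 [bib: `ConnesConsani2021QuasiInner`], §4.4 «Quasi-inner functions and
infinitesimals» (arXiv chunk p0014:L58–L64).  THEOREMS ONLY (no definition, no named fact).  Cell
`rh-crit/cc`, row t18 (§4–§5).

## The printed argument (p0014:L64) and what is here

«It follows from Lemma 4.7 that the product `u = ρ_∞ ∏ ρ_v` of `m + 1` ratios of local factors over a
finite set of places containing the archimedean one can be written as a product of `m` functions of
the form `ρ_∞^{(m,k)}ρ_v` … Theorem 4.4 (and its proof) apply with `ρ_∞^{(m,k)}` in place of `ρ_∞` …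
the decay of `|ρ_∞^{(m,k)}(2πin/log p)|` is `O(|n|^{−1/(2m)})` … For `2 × 2` operator matrices the
`(·)₂₁` entry of a product is a sum of products each containing at least one `(·)₂₁` factor, the others
being bounded; simple algebraic manipulation shows that one thus gets an infinitesimal of order `1/(2m)`.»

This file proves the two RH-free operator-algebra steps of that paragraph and packages the reduction:

* §A (abstract, any projection `P`): `isInfinitesimalOfOrder_offDiag_mul` — if `(1 − P)uP` and
  `(1 − P)vP` are infinitesimals of order `α ≥ 0` then so is `(1 − P)uvP`
  (`(1 − P)uvP = [(1 − P)uP](vP) + [(1 − P)u][(1 − P)vP]`, the tree's `offDiag_mul`, and Connes' two-sided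
  ideal `IsInfinitesimalOfOrder.comp_left/.comp_right/.add`); `offDiag_one` (`(1 − P)P = 0`).
* §B (multiplication operators): `mulOp_toLpOrZero_mul` — `M_{fg} = M_f M_g` for `f, g ∈ L^∞`;
  `mulOp_toLpOrZero_one` — `M_1 = 1`.
* §C (symbols on `S¹`): closure of «`u ∈ L^∞` unimodular, `(1 − 𝒫)u𝒫` compact / of order `α`» under
  products of two symbols (`isQuasiInner_mul`, `isInfinitesimalOfOrder_hardyOffDiag_mul`) and under
  finite products (`finsetProd_quasiInner_order`).
* §D (Theorem 4.8 ⇐ its factors): `placeRatio_eq_finProd` — `ρ_∞∏_{p∈F}ρ_p = ∏_{i<m} ρ_∞^{(m,i)}ρ_{p_i}`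
  for any enumeration `p_0, …, p_{m−1}` of `F` (Lemma 4.7, t18's PROVED `lemma_4_7_prod`); the per-factor
  frame `memLp_circleRestrict_rhoFactor_mul_kappaPrime` (each `κ^{(m,k)}κ_p|S¹ ∈ L^∞` is unimodular) and
  `isQuasiInnerLeftHalfPlane_rhoFactor_mul_rhoPrime_of_order` (order `> 0` ⇒ quasi-inner, t17's
  `isCompactOperator_of_isInfinitesimalOfOrder`); and the reductions
  `thm_4_8_of_factorOrder : (∀ m k p, 0 < m → k < m → p.Prime → (1 − 𝒫)κ^{(m,k)}κ_p𝒫 of order 1/(2m)) →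
  thm_4_8` and `thm_4_8_of_factorwise` (same with the printed pair «quasi-inner ∧ order» as hypothesis).

* §E (the `D`-brick of the per-factor estimate): `exists_norm_rhoFactor_primePole_le` — «the decay of
  `|ρ_∞^{(m,k)}(2πin/log p)|` is `O(|n|^{−1/2m})` using (4.6) (i)», as a uniform bound
  `C(|n|+1)^{−1/(2m)}` over all `n ≠ 0` (t18's `lemma_4_6_i` for `|t| ≥ 2m`, compactness below); and
  `exists_diag_rhoFactor_primePole` — the diagonal operator `Dδ_0 = 0`, `Dδ_n = ρ_∞^{(m,k)}(2πin/log p)δ_n`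
  of eq. (4.4) with `ρ_∞^{(m,k)}` in place of `ρ_∞` exists on `ℓ²(ℤ)` and is an infinitesimal of order
  `1/(2m)` (t17's `exists_lpDiagonal`, `isInfinitesimalOfOrder_of_diag`).

What is NOT here (the analytic layer, cell seats t16/t17): the order-`1/(2m)` estimate for each
`(1 − 𝒫)κ^{(m,k)}κ_p𝒫` («Theorem 4.4 and its proof apply with `ρ_∞^{(m,k)}` in place of `ρ_∞`»).  With
it, `thm_4_8_holds := thm_4_8_of_factorOrder ‹that estimate›`.

Nothing in this file bears on the truth of RH.
-/

noncomputable section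

open _root_.MeasureTheory _root_.Complex AddCircle Filter Set
open scoped Real ENNReal InnerProductSpace Topology

namespace Literature.NumberTheory.ConnesConsani2021

namespace QuasiInner

/-! ### A. The off-diagonal corner of a product (any projection `P`) -/

section Abstract

variable {H : Type*} [NormedAddCommGroup H] [InnerProductSpace ℂ H]

/-- RH-FREE. **Products keep the order of the off-diagonal corner**: if `(1 − P)uP` and `(1 − P)vP` are
infinitesimals of order `α ≥ 0` then so is `(1 − P)(uv)P` — «for `2 × 2` matrices the `(·)₂₁` entry of a
product is a sum of products each containing one `(·)₂₁` factor, the others bounded»: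
`(1 − P)uvP = [(1 − P)uP](vP) + [(1 − P)u][(1 − P)vP]` and infinitesimals of order `α` form a two-sided
ideal. [cite: ConnesConsani2021QuasiInner, §4.4 proof of Thm 4.8 (arXiv chunk p0014:L64)] -/
theorem isInfinitesimalOfOrder_offDiag_mul {P u v : H →L[ℂ] H} {α : ℝ} (hα : 0 ≤ α)
    (hu : IsInfinitesimalOfOrder (offDiag P u) α) (hv : IsInfinitesimalOfOrder (offDiag P v) α) :
    IsInfinitesimalOfOrder (offDiag P (u * v)) α := by
  rw [offDiag_mul]
  exact (hu.comp_right (v * P)).add hα (hv.comp_left ((1 - P) * u))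

/-- RH-FREE. For an idempotent `P` the identity has no off-diagonal corner: `(1 − P)·1·P = P − P² = 0`
(«inner functions are quasi-inner since … `(1 − 𝒫)u𝒫 = 0`», here for the constant `u = 1`).
[cite: ConnesConsani2021QuasiInner, Introduction (arXiv chunk p0003:L7)] -/
theorem offDiag_one {P : H →L[ℂ] H} (hP : IsIdempotentElem P) : offDiag P 1 = 0 := by
  rw [offDiag_def, mul_one, sub_mul, one_mul, hP.eq, sub_self]

/-- RH-FREE. The zero operator is an infinitesimal of every order (`μ_n(0) = 0`; the trivial member of
Connes' two-sided ideal of infinitesimals of order `α`).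
[cite: Connes1994, Introduction, quantized-calculus dictionary «infinitesimals of order α» (cf. Chap. IV §2)] -/
theorem isInfinitesimalOfOrder_zero (α : ℝ) : IsInfinitesimalOfOrder (0 : H →L[ℂ] H) α := by
  refine ⟨0, fun n => ?_⟩
  have h0 : approxNumber (0 : H →L[ℂ] H) n = 0 :=
    le_antisymm ((approxNumber_le_opNorm (0 : H →L[ℂ] H) n).trans (by rw [norm_zero]))
      (approxNumber_nonneg' _ n)
  rw [h0, zero_mul]

end Abstract

/-! ### B. Multiplication operators: `M_{fg} = M_f M_g`, `M_1 = 1` -/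

section MulOp

variable {α : Type*} [MeasurableSpace α] {μ : Measure α}

/-- RH-FREE. The `L^∞` class of an `L^∞` function is a.e. the function (unfolding of `toLpOrZero`, the
vector «`u ∈ L^∞(∂Ω)`» of the Definition versus the function `u`).
[cite: ConnesConsani2021QuasiInner, Introduction, Definition (arXiv chunk p0003:L5)] -/
theorem coeFn_toLpOrZero {f : α → ℂ} (hf : MemLp f ∞ μ) :
    ((toLpOrZero ∞ μ f : Lp ℂ ∞ μ) : α → ℂ) =ᵐ[μ] f := by
  rw [toLpOrZero_eq_toLp hf]
  exact hf.coeFn_toLp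

/-- RH-FREE. **`M_{fg} = M_f M_g`** for `f, g ∈ L^∞(μ)`: multiplication operators multiply («`u` acts on
`L²(∂Ω)` by multiplication»; the product of two quasi-inner FUNCTIONS acts as the product of the two
operators). [cite: ConnesConsani2021QuasiInner, Introduction (arXiv chunk p0003:L5–L7)] -/
theorem mulOp_toLpOrZero_mul {f g : α → ℂ} (hf : MemLp f ∞ μ) (hg : MemLp g ∞ μ) :
    mulOp μ (toLpOrZero ∞ μ (f * g)) = mulOp μ (toLpOrZero ∞ μ f) * mulOp μ (toLpOrZero ∞ μ g) := by
  have hfg : MemLp (f * g) ∞ μ := hg.mul hf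
  ext1 h
  change mulOp μ (toLpOrZero ∞ μ (f * g)) h =
    mulOp μ (toLpOrZero ∞ μ f) (mulOp μ (toLpOrZero ∞ μ g) h)
  apply Lp.ext
  filter_upwards [coeFn_mulOp μ (toLpOrZero ∞ μ (f * g)) h,
    coeFn_mulOp μ (toLpOrZero ∞ μ f) (mulOp μ (toLpOrZero ∞ μ g) h),
    coeFn_mulOp μ (toLpOrZero ∞ μ g) h, coeFn_toLpOrZero hfg, coeFn_toLpOrZero hf,
    coeFn_toLpOrZero hg] with x h1 h2 h3 h4 h5 h6
  rw [h1, h2, h3, h4, h5, h6, Pi.mul_apply, mul_assoc]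

/-- RH-FREE. **`M_1 = 1`**: multiplication by the constant `1` is the identity of `L²(μ)` (the constant
inner function `u = 1` «acts on `L²(∂Ω)` by multiplication» as the identity).
[cite: ConnesConsani2021QuasiInner, Introduction, Definition (arXiv chunk p0003:L5–L7)] -/
theorem mulOp_toLpOrZero_one : mulOp μ (toLpOrZero ∞ μ (1 : α → ℂ)) = 1 := by
  have h1 : MemLp (1 : α → ℂ) ∞ μ := memLp_top_const (1 : ℂ)
  ext1 h
  change mulOp μ (toLpOrZero ∞ μ (1 : α → ℂ)) h = h
  apply Lp.ext
  filter_upwards [coeFn_mulOp μ (toLpOrZero ∞ μ (1 : α → ℂ)) h, coeFn_toLpOrZero h1] with x hx h2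
  rw [hx, h2, Pi.one_apply, one_mul]

/-- RH-FREE. Unimodular functions are closed under products (`|fg| = |f||g| = 1` a.e.) — the modulus-one
clause of «the product of two quasi-inner functions is also quasi-inner».
[cite: ConnesConsani2021QuasiInner, Introduction (arXiv chunk p0003:L5–L7)] -/
theorem ae_norm_mul_eq_one {f g : α → ℂ} (hf : ∀ᵐ x ∂μ, ‖f x‖ = 1) (hg : ∀ᵐ x ∂μ, ‖g x‖ = 1) :
    ∀ᵐ x ∂μ, ‖(f * g) x‖ = 1 := by
  filter_upwards [hf, hg] with x h1 h2
  rw [Pi.mul_apply, norm_mul, h1, h2, mul_one]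

end MulOp

/-! ### C. Symbols on the circle: products of quasi-inner functions with corners of order `α` -/

section Circle

variable (T : ℝ) [hT : Fact (0 < T)]

/-- RH-FREE. `(1 − 𝒫)·1·𝒫 = 0`: the constant symbol `1` has no off-diagonal part. [cite: ConnesConsani2021QuasiInner, Introduction (arXiv chunk p0003:L7)] -/
theorem hardyOffDiag_one :
    hardyOffDiag T (toLpOrZero ∞ haarAddCircle (1 : AddCircle T → ℂ)) = 0 := by
  rw [hardyOffDiag, mulOp_toLpOrZero_one]
  exact offDiag_one (Submodule.isIdempotentElem_starProjection _)

/-- RH-FREE. The constant symbol `1` is quasi-inner (indeed inner) with off-diagonal part of every order.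
[cite: ConnesConsani2021QuasiInner, Introduction (arXiv chunk p0003:L7)] -/
theorem isQuasiInner_one (α : ℝ) :
    MemLp (1 : AddCircle T → ℂ) ∞ (haarAddCircle (T := T)) ∧
      IsQuasiInner T (toLpOrZero ∞ haarAddCircle (1 : AddCircle T → ℂ)) ∧
        IsInfinitesimalOfOrder (hardyOffDiag T (toLpOrZero ∞ haarAddCircle (1 : AddCircle T → ℂ))) α := by
  have h1 : MemLp (1 : AddCircle T → ℂ) ∞ (haarAddCircle (T := T)) := memLp_top_const (1 : ℂ)
  refine ⟨h1, ⟨?_, ?_⟩, ?_⟩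
  · filter_upwards [coeFn_toLpOrZero h1] with x hx
    rw [hx, Pi.one_apply, norm_one]
  · show IsCompactOperator (hardyOffDiag T (toLpOrZero ∞ haarAddCircle (1 : AddCircle T → ℂ)))
    rw [hardyOffDiag_one]
    exact isCompactOperator_zero
  · rw [hardyOffDiag_one]
    exact isInfinitesimalOfOrder_zero α

/-- RH-FREE. **«The product of two quasi-inner functions is also quasi-inner»**, for symbols given as
`L^∞` functions on `S¹`: `fg` is unimodular and `(1 − 𝒫)M_{fg}𝒫 = (1 − 𝒫)M_fM_g𝒫` is compact.
[cite: ConnesConsani2021QuasiInner, Introduction (arXiv chunk p0003:L7)] -/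
theorem isQuasiInner_mul {f g : AddCircle T → ℂ} (hf : MemLp f ∞ (haarAddCircle (T := T)))
    (hg : MemLp g ∞ (haarAddCircle (T := T))) (hqf : IsQuasiInner T (toLpOrZero ∞ haarAddCircle f))
    (hqg : IsQuasiInner T (toLpOrZero ∞ haarAddCircle g)) :
    IsQuasiInner T (toLpOrZero ∞ haarAddCircle (f * g)) := by
  have hfg : MemLp (f * g) ∞ (haarAddCircle (T := T)) := hg.mul hf
  refine ⟨?_, ?_⟩
  · have hf1 : ∀ᵐ x ∂(haarAddCircle (T := T)), ‖f x‖ = 1 := by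
      filter_upwards [hqf.1, coeFn_toLpOrZero hf] with x h1 h2
      rw [← h2]; exact h1
    have hg1 : ∀ᵐ x ∂(haarAddCircle (T := T)), ‖g x‖ = 1 := by
      filter_upwards [hqg.1, coeFn_toLpOrZero hg] with x h1 h2
      rw [← h2]; exact h1
    filter_upwards [ae_norm_mul_eq_one hf1 hg1, coeFn_toLpOrZero hfg] with x h1 h2
    rw [h2]; exact h1
  · show IsQuasiInnerRel (hardyProjection T) (mulOp haarAddCircle (toLpOrZero ∞ haarAddCircle (f * g)))
    rw [mulOp_toLpOrZero_mul hf hg]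
    exact hqf.2.mul hqg.2

/-- RH-FREE. **Products keep the order of the off-diagonal part** (symbols on `S¹`): if `(1 − 𝒫)f𝒫` and
`(1 − 𝒫)g𝒫` are infinitesimals of order `α ≥ 0` (`f, g ∈ L^∞`) then so is `(1 − 𝒫)fg𝒫`.
[cite: ConnesConsani2021QuasiInner, §4.4 proof of Thm 4.8 (arXiv chunk p0014:L64)] -/
theorem isInfinitesimalOfOrder_hardyOffDiag_mul {f g : AddCircle T → ℂ} {α : ℝ} (hα : 0 ≤ α)
    (hf : MemLp f ∞ (haarAddCircle (T := T))) (hg : MemLp g ∞ (haarAddCircle (T := T)))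
    (hof : IsInfinitesimalOfOrder (hardyOffDiag T (toLpOrZero ∞ haarAddCircle f)) α)
    (hog : IsInfinitesimalOfOrder (hardyOffDiag T (toLpOrZero ∞ haarAddCircle g)) α) :
    IsInfinitesimalOfOrder (hardyOffDiag T (toLpOrZero ∞ haarAddCircle (f * g))) α := by
  unfold hardyOffDiag at hof hog ⊢
  rw [mulOp_toLpOrZero_mul hf hg]
  exact isInfinitesimalOfOrder_offDiag_mul hα hof hog

/-- RH-FREE. **Finite products** («simple algebraic manipulation shows that one thus gets an infinitesimal of
order `1/(2m)`»): if each symbol `g_i ∈ L^∞(S¹)` (`i ∈ s`) is quasi-inner with off-diagonal part of order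
`α ≥ 0`, then so is `∏_{i∈s} g_i`. [cite: ConnesConsani2021QuasiInner, §4.4 proof of Thm 4.8 (arXiv chunk p0014:L64)] -/
theorem finsetProd_quasiInner_order {ι : Type*} (s : Finset ι) {g : ι → AddCircle T → ℂ} {α : ℝ}
    (hα : 0 ≤ α) (hmem : ∀ i ∈ s, MemLp (g i) ∞ (haarAddCircle (T := T)))
    (hq : ∀ i ∈ s, IsQuasiInner T (toLpOrZero ∞ haarAddCircle (g i)))
    (hord : ∀ i ∈ s, IsInfinitesimalOfOrder (hardyOffDiag T (toLpOrZero ∞ haarAddCircle (g i))) α) :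
    MemLp (∏ i ∈ s, g i) ∞ (haarAddCircle (T := T)) ∧
      IsQuasiInner T (toLpOrZero ∞ haarAddCircle (∏ i ∈ s, g i)) ∧
        IsInfinitesimalOfOrder (hardyOffDiag T (toLpOrZero ∞ haarAddCircle (∏ i ∈ s, g i))) α := by
  induction s using Finset.cons_induction with
  | empty =>
    rw [Finset.prod_empty]
    exact isQuasiInner_one T α
  | cons a s ha ih =>
    have hmem' : ∀ i ∈ s, MemLp (g i) ∞ (haarAddCircle (T := T)) :=
      fun i hi => hmem i (Finset.mem_cons_of_mem hi)
    have hq' : ∀ i ∈ s, IsQuasiInner T (toLpOrZero ∞ haarAddCircle (g i)) :=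
      fun i hi => hq i (Finset.mem_cons_of_mem hi)
    have hord' : ∀ i ∈ s, IsInfinitesimalOfOrder (hardyOffDiag T (toLpOrZero ∞ haarAddCircle (g i))) α :=
      fun i hi => hord i (Finset.mem_cons_of_mem hi)
    obtain ⟨h1, h2, h3⟩ := ih hmem' hq' hord'
    have ha1 := hmem a (Finset.mem_cons_self a s)
    have ha2 := hq a (Finset.mem_cons_self a s)
    have ha3 := hord a (Finset.mem_cons_self a s)
    rw [Finset.prod_cons]
    exact ⟨h1.mul ha1, isQuasiInner_mul T ha1 h1 ha2 h2,
      isInfinitesimalOfOrder_hardyOffDiag_mul T hα ha1 h1 ha3 h3⟩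

end Circle

/-! ### D. Theorem 4.8 reduced to its factors `ρ_∞^{(m,k)}ρ_p` -/

section Reduction

/-- RH-FREE. **Lemma 4.7 applied to `u = ρ_∞∏ρ_p`**: for a finite set `F` of `m ≥ 1` primes enumerated as
`p_0, …, p_{m−1}` (here by `F.equivFin`), `ρ_∞(z)∏_{p∈F}ρ_p(z) = ∏_{i<m} ρ_∞^{(m,i)}(z)ρ_{p_i}(z)` («the
product `u` … can be written as a product of `m` functions of the form `ρ_∞^{(m,k)}ρ_v`»; t18's PROVED
`lemma_4_7_prod`: `∏_{k<m}ρ_∞^{(m,k)} = ρ_∞`). [cite: ConnesConsani2021QuasiInner, §4.4 proof of Thm 4.8 (arXiv chunk p0014:L64) with Lemma 4.7 (p0014:L54)] -/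
theorem placeRatio_eq_finProd (F : Finset Nat.Primes) (hF : F.Nonempty) (z : ℂ) :
    placeRatio F z =
      ∏ i : Fin F.card, (rhoFactor F.card i z * rhoPrime ((F.equivFin.symm i : F) : ℕ) z) := by
  have hm : 0 < F.card := Finset.card_pos.mpr hF
  rw [Finset.prod_mul_distrib, placeRatio_def, ← lemma_4_7_prod_rhoArch hm z,
    ← Fin.prod_univ_eq_prod_range (fun k => rhoFactor F.card k z) F.card, ← Finset.prod_coe_sort F]
  congr 1
  exact Fintype.prod_equiv F.equivFin (fun x : F => rhoPrime ((x : Nat.Primes) : ℕ) z)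
    (fun i => rhoPrime ((F.equivFin.symm i : F) : ℕ) z) (fun x => by rw [Equiv.symm_apply_apply])

/-- RH-FREE. The boundary symbol of `u = ρ_∞∏_{p∈F}ρ_p` on `S¹` is the product of the `m` symbols
`v ↦ ρ_∞^{(m,i)}(ψ(v))κ_{p_i}(v)` (`κ_p = ρ_p ∘ ψ`). [cite: ConnesConsani2021QuasiInner, §4.4 proof of Thm 4.8 (arXiv chunk p0014:L64)] -/
theorem circleRestrict_placeRatio_eq_finProd (F : Finset Nat.Primes) (hF : F.Nonempty) :
    circleRestrict 1 (placeRatio F ∘ cayley) =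
      ∏ i : Fin F.card, circleRestrict 1
        (fun v => rhoFactor F.card i (cayley v) * kappaPrime ((F.equivFin.symm i : F) : ℕ) v) := by
  funext x
  rw [Finset.prod_apply]
  exact placeRatio_eq_finProd F hF _

/-- RH-FREE. **The per-factor frame**: each boundary symbol `κ^{(m,k)}κ_p|S¹` (`m ≥ 1`, `p > 1`) is in
`L^∞(S¹)`, unimodular at every point (Lemma 4.7: `|ρ_∞^{(m,k)}| = 1` on `∂ℂ₋`, t17's
`norm_circleRestrict_rhoFactor`; `|κ_p| = 1`, t17's `norm_circleRestrict_kappaPrime`), and its `L^∞` class is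
a.e. the function. [cite: ConnesConsani2021QuasiInner, Lemma 4.7 (arXiv chunk p0014:L48–L56) with §3 (p0008:L21)] -/
theorem memLp_circleRestrict_rhoFactor_mul_kappaPrime {m : ℕ} (hm : 0 < m) (k : ℕ) {p : ℕ} (hp : 1 < p) :
    MemLp (circleRestrict 1 fun v => rhoFactor m k (cayley v) * kappaPrime p v) ∞ (haarAddCircle (T := 1)) ∧
      (∀ x : AddCircle (1 : ℝ), ‖circleRestrict 1 (fun v => rhoFactor m k (cayley v) * kappaPrime p v) x‖ = 1) ∧
        ((toLpOrZero ∞ haarAddCircle (circleRestrict 1 fun v => rhoFactor m k (cayley v) * kappaPrime p v) :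
            Lp ℂ ∞ (haarAddCircle (T := 1))) : AddCircle (1 : ℝ) → ℂ) =ᵐ[haarAddCircle (T := 1)]
          circleRestrict 1 fun v => rhoFactor m k (cayley v) * kappaPrime p v := by
  have h1 := memLp_circleRestrict_rhoFactor hm k
  obtain ⟨h2, -, -⟩ := memLp_circleRestrict_kappaPrime hp
  have heq : (circleRestrict 1 fun v => rhoFactor m k (cayley v) * kappaPrime p v) =
      circleRestrict 1 (rhoFactor m k ∘ cayley) * circleRestrict 1 (kappaPrime p) := rfl
  have hnorm : ∀ x : AddCircle (1 : ℝ),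
      ‖circleRestrict 1 (fun v => rhoFactor m k (cayley v) * kappaPrime p v) x‖ = 1 := by
    intro x
    rw [heq, Pi.mul_apply, norm_mul, norm_circleRestrict_rhoFactor hm k x,
      norm_circleRestrict_kappaPrime (T := 1) hp x, mul_one]
  have hmem : MemLp (circleRestrict 1 fun v => rhoFactor m k (cayley v) * kappaPrime p v) ∞
      (haarAddCircle (T := 1)) := by
    rw [heq]
    exact h2.mul h1
  exact ⟨hmem, hnorm, coeFn_toLpOrZero hmem⟩

/-- RH-FREE. **Quasi-inner from the order estimate**: if `(1 − 𝒫)κ^{(m,k)}κ_p𝒫` is an infinitesimal of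
some order `α > 0` then `ρ_∞^{(m,k)}ρ_p` is quasi-inner relative to `ℂ₋` (order `> 0` ⇒ compact, t17's
`isCompactOperator_of_isInfinitesimalOfOrder`; unimodularity by the per-factor frame) — the quasi-inner
half of «Theorem 4.4 (and its proof) apply with `ρ_∞^{(m,k)}` in place of `ρ_∞`» costs nothing beyond the
order half. [cite: ConnesConsani2021QuasiInner, §4.4 proof of Thm 4.8 (arXiv chunk p0014:L64)] -/
theorem isQuasiInnerLeftHalfPlane_rhoFactor_mul_rhoPrime_of_order {m k p : ℕ} (hm : 0 < m)
    (hp : 1 < p) {α : ℝ} (hα : 0 < α)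
    (hord : IsInfinitesimalOfOrder
      (hardyOffDiag 1 (toLpOrZero ∞ haarAddCircle
        (circleRestrict 1 fun v => rhoFactor m k (cayley v) * kappaPrime p v))) α) :
    IsQuasiInnerLeftHalfPlane (fun z => rhoFactor m k z * rhoPrime p z) := by
  have hk : circleRestrict 1 ((fun z => rhoFactor m k z * rhoPrime p z) ∘ cayley) =
      circleRestrict 1 fun v => rhoFactor m k (cayley v) * kappaPrime p v := rfl
  obtain ⟨hmem, hnorm, hae⟩ := memLp_circleRestrict_rhoFactor_mul_kappaPrime hm k hp
  refine ⟨hk ▸ hmem, ?_, ?_⟩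
  · rw [hk]
    filter_upwards [hae] with x hx
    rw [hx]
    exact hnorm x
  · rw [hk]
    exact isCompactOperator_of_isInfinitesimalOfOrder hα hord

/-- RH-FREE. **Theorem 4.8 reduced to the order estimate for its factors** (the printed proof, p0014:L64,
minus its one analytic input): IF for all `m ≥ 1`, `0 ≤ k < m` and primes `p` the off-diagonal part
`(1 − 𝒫)κ^{(m,k)}κ_p𝒫` of the symbol `ρ_∞^{(m,k)}ρ_p` is an infinitesimal of order `1/(2m)` («Theorem 4.4
(and its proof) apply with `ρ_∞^{(m,k)}` in place of `ρ_∞` … the decay … is `O(|n|^{−1/(2m)})`»), THEN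
Theorem 4.8 holds: for every nonempty finite set `F` of `m` primes, `ρ_∞∏_{p∈F}ρ_p` is quasi-inner
relative to `ℂ₋` and `(1 − 𝒫)ρ_∞∏ρ_p𝒫` is of order `1/(2m)` (write `u = ∏_{i<m}ρ_∞^{(m,i)}ρ_{p_i}` by
Lemma 4.7 and multiply `m` triangular-modulo-order-`1/(2m)` matrices).  No new fact: the hypothesis is
the remaining analytic input, supplied by the cell's analytic layer.
[cite: ConnesConsani2021QuasiInner, Thm 4.8 and its proof (arXiv chunk p0014:L62–L64)] -/
theorem thm_4_8_of_factorOrder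
    (hB : ∀ m k p : ℕ, 0 < m → k < m → p.Prime →
      IsInfinitesimalOfOrder
        (hardyOffDiag 1 (toLpOrZero ∞ haarAddCircle
          (circleRestrict 1 fun v => rhoFactor m k (cayley v) * kappaPrime p v)))
        (1 / (2 * (m : ℝ)))) :
    thm_4_8 := by
  intro F hF
  have hm : 0 < F.card := Finset.card_pos.mpr hF
  have hα : (0 : ℝ) < 1 / (2 * (F.card : ℝ)) := by
    have : (0 : ℝ) < F.card := Nat.cast_pos.mpr hm
    positivity
  set g : Fin F.card → AddCircle (1 : ℝ) → ℂ := fun i =>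
    circleRestrict 1 fun v => rhoFactor F.card i (cayley v) * kappaPrime ((F.equivFin.symm i : F) : ℕ) v
    with hg
  have hprime : ∀ i : Fin F.card, (((F.equivFin.symm i : F) : Nat.Primes) : ℕ).Prime :=
    fun i => ((F.equivFin.symm i : F) : Nat.Primes).2
  have hmem : ∀ i ∈ (Finset.univ : Finset (Fin F.card)), MemLp (g i) ∞ (haarAddCircle (T := 1)) :=
    fun i _ => (memLp_circleRestrict_rhoFactor_mul_kappaPrime hm i (hprime i).one_lt).1
  have hord : ∀ i ∈ (Finset.univ : Finset (Fin F.card)),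
      IsInfinitesimalOfOrder (hardyOffDiag 1 (toLpOrZero ∞ haarAddCircle (g i))) (1 / (2 * (F.card : ℝ))) :=
    fun i _ => hB F.card i _ hm i.isLt (hprime i)
  have hq : ∀ i ∈ (Finset.univ : Finset (Fin F.card)), IsQuasiInner 1 (toLpOrZero ∞ haarAddCircle (g i)) :=
    fun i hi => (isQuasiInnerLeftHalfPlane_rhoFactor_mul_rhoPrime_of_order hm (hprime i).one_lt hα
      (hord i hi)).2
  obtain ⟨h1, h2, h3⟩ := finsetProd_quasiInner_order 1 Finset.univ hα.le hmem hq hord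
  have hsym : circleRestrict 1 (placeRatio F ∘ cayley) = ∏ i : Fin F.card, g i :=
    circleRestrict_placeRatio_eq_finProd F hF
  refine ⟨⟨?_, ?_⟩, ?_⟩
  · rw [hsym]; exact h1
  · rw [hsym]; exact h2
  · rw [hsym]; exact h3

/-- RH-FREE. **Theorem 4.8 reduced to Theorem 4.4 for the factors `ρ_∞^{(m,k)}ρ_p`**, hypothesis in the
printed pair form «`ρ_∞^{(m,k)}ρ_p` is quasi-inner relative to `ℂ₋` and its off-diagonal part is an
infinitesimal of order `1/(2m)`» (only the order half is used: `thm_4_8_of_factorOrder`).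
[cite: ConnesConsani2021QuasiInner, Thm 4.8 and its proof (arXiv chunk p0014:L62–L64)] -/
theorem thm_4_8_of_factorwise
    (hB : ∀ m k p : ℕ, 0 < m → k < m → p.Prime →
      IsQuasiInnerLeftHalfPlane (fun z => rhoFactor m k z * rhoPrime p z) ∧
        IsInfinitesimalOfOrder
          (hardyOffDiag 1 (toLpOrZero ∞ haarAddCircle
            (circleRestrict 1 fun v => rhoFactor m k (cayley v) * kappaPrime p v)))
          (1 / (2 * (m : ℝ)))) :
    thm_4_8 :=
  thm_4_8_of_factorOrder fun m k p hm hk hp => (hB m k p hm hk hp).2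

end Reduction

/-! ### E. The `D`-brick of the proof of Theorem 4.8: the decay of `ρ_∞^{(m,k)}` at the poles
`2πin/log p` of `ρ_p`, and the diagonal operator `D^{(m,k)}` of order `1/(2m)` -/

section Decay

/-- RH-FREE. `|ρ_∞^{(m,k)}(it)| = (π/m)^{1/(2m)} |φ_{m,k}(it)|` on the imaginary axis (the prefactor
`(π/m)^{1/(2m) − z/m}` of eq. (4.7) has modulus `(π/m)^{1/(2m)}` for `Re z = 0`).
[cite: ConnesConsani2021QuasiInner, Lemma 4.7 eq. (4.7) (arXiv chunk p0014:L51)] -/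
theorem norm_rhoFactor_mul_I {m : ℕ} (hm : 0 < m) (k : ℕ) (t : ℝ) :
    ‖rhoFactor m k (t * I)‖ = (π / m) ^ (1 / (2 * (m : ℝ))) * ‖phiFactor m k (t * I)‖ := by
  have hm0 : (0 : ℝ) < m := Nat.cast_pos.mpr hm
  have hm' : (m : ℂ) ≠ 0 := Nat.cast_ne_zero.mpr hm.ne'
  rw [rhoFactor_def, norm_mul, show ((π : ℂ) / m) = (((π / m : ℝ)) : ℂ) by push_cast; rfl,
    norm_cpow_eq_rpow_re_of_pos (by positivity : (0 : ℝ) < π / m)]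
  have hre : (1 / (2 * (m : ℂ)) - (t : ℂ) * I / m).re = 1 / (2 * (m : ℝ)) := by
    have e : (1 / (2 * (m : ℂ)) - (t : ℂ) * I / m) =
        ((1 / (2 * (m : ℝ)) : ℝ) : ℂ) + ((-(t / m) : ℝ) : ℂ) * I := by
      push_cast
      field_simp
      ring
    rw [e, add_re, ofReal_re, re_ofReal_mul, I_re, mul_zero, add_zero]
  rw [hre]

/-- RH-FREE. `γ_{m,k}` has no pole on the punctured imaginary axis: `γ_{m,k}(it) ≠ 0` for `t ≠ 0` (the
poles `−2k − 2nm` are real). [cite: ConnesConsani2021QuasiInner, Lemma 4.7 proof (arXiv chunk p0014:L56)] -/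
theorem gammaFactor_mul_I_ne_zero {m : ℕ} (hm : 0 < m) (k : ℕ) {t : ℝ} (ht : t ≠ 0) :
    gammaFactor m k (t * I) ≠ 0 := by
  intro h
  obtain ⟨n, hn⟩ := (gammaFactor_eq_zero_iff hm k _).1 h
  have him := congrArg Complex.im hn
  simp at him
  exact ht him

/-- RH-FREE. `ρ_∞^{(m,k)}` is continuous on the punctured imaginary axis (holomorphic off its real poles).
[cite: ConnesConsani2021QuasiInner, Lemma 4.7 proof (arXiv chunk p0014:L56)] -/
theorem continuousAt_rhoFactor_mul_I {m : ℕ} (hm : 0 < m) (k : ℕ) {t : ℝ} (ht : t ≠ 0) :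
    ContinuousAt (fun s : ℝ => rhoFactor m k (s * I)) t := by
  have hc : Continuous fun s : ℝ => (s : ℂ) * I := continuous_ofReal.mul continuous_const
  have h1 : ContinuousAt (rhoFactor m k) ((t : ℂ) * I) :=
    (differentiableAt_rhoFactor hm k (gammaFactor_mul_I_ne_zero hm k ht)).continuousAt
  exact h1.comp (f := fun s : ℝ => (s : ℂ) * I) hc.continuousAt

/-- RH-FREE. **The decay of `ρ_∞^{(m,k)}` at the poles of `ρ_p`**: «the decay of `|ρ_∞^{(m,k)}(2πin/log p)|`
is `O(|n|^{−1/2m})` using (4.6) (i)» — for `m ≥ 1`, any `k`, `p > 1` there is `C` with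
`|ρ_∞^{(m,k)}(2πin/log p)| ≤ C(|n|+1)^{−1/(2m)}` for all `n ≠ 0` (Lemma 4.6 (i), t18's `lemma_4_6_i`, for
`|t| ≥ 2m`; continuity on the compact range `2π/log p ≤ |t| ≤ 2m` for the finitely many other `n`).
[cite: ConnesConsani2021QuasiInner, §4.4 proof of Thm 4.8 (arXiv chunk p0014:L64) with Lemma 4.6 (i) (p0013:L84)] -/
theorem exists_norm_rhoFactor_primePole_le {m : ℕ} (hm : 0 < m) (k : ℕ) {p : ℕ} (hp : 1 < p) :
    ∃ C : ℝ, ∀ n : ℤ, n ≠ 0 →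
      ‖rhoFactor m k (2 * π * I * n / Real.log p)‖ ≤
        C * ((|n| : ℝ) + 1) ^ (-(1 / (2 * (m : ℝ)))) := by
  have hm0 : (0 : ℝ) < m := Nat.cast_pos.mpr hm
  have hL : 0 < Real.log p := Real.log_pos (by exact_mod_cast hp)
  set α : ℝ := 1 / (2 * (m : ℝ)) with hα
  have hαpos : 0 < α := by positivity
  set A : ℝ := (π / m) ^ α with hA
  have hApos : 0 < A := Real.rpow_pos_of_pos (by positivity) α
  set c : ℝ := 2 * π / Real.log p with hc
  have hcpos : 0 < c := by positivity
  -- large `|t|`: Lemma 4.6 (i)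
  obtain ⟨C₁, hC₁⟩ := lemma_4_6_i hm k
  -- small `|t|`: continuity on a compact set
  set K : Set ℝ := Set.Icc (-(2 * (m : ℝ))) (-c) ∪ Set.Icc c (2 * m) with hK
  have hKc : IsCompact K := isCompact_Icc.union isCompact_Icc
  have hK0 : ∀ t ∈ K, t ≠ 0 := by
    intro t ht h0
    rw [h0] at ht
    rcases ht with ⟨-, h⟩ | ⟨h, -⟩ <;> linarith
  have hcont : ContinuousOn (fun s : ℝ => rhoFactor m k (s * I)) K :=
    fun t ht => (continuousAt_rhoFactor_mul_I hm k (hK0 t ht)).continuousWithinAt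
  obtain ⟨B, hB⟩ := hKc.exists_bound_of_continuousOn hcont
  -- the constant
  set C : ℝ := A * max C₁ 0 * c ^ (-α) * (2 : ℝ) ^ α + max B 0 * (2 * m / c + 1) ^ α with hCdef
  have hT1 : 0 ≤ A * max C₁ 0 * c ^ (-α) * (2 : ℝ) ^ α := by positivity
  have hT2 : 0 ≤ max B 0 * (2 * m / c + 1) ^ α := by positivity
  refine ⟨C, fun n hn => ?_⟩
  set t : ℝ := 2 * π * n / Real.log p with ht
  have hn1 : (1 : ℝ) ≤ |(n : ℝ)| := by
    rw [← Int.cast_abs]; exact_mod_cast Int.one_le_abs hn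
  have htabs : |t| = c * |(n : ℝ)| := by
    rw [ht, hc, abs_div, abs_mul, abs_of_pos (by positivity : (0 : ℝ) < 2 * π), abs_of_pos hL]
    ring
  have htc : c ≤ |t| := by
    rw [htabs]; exact le_mul_of_one_le_right hcpos.le hn1
  have htpos : 0 < |t| := lt_of_lt_of_le hcpos htc
  have hz : (2 * π * I * n / Real.log p : ℂ) = (t : ℂ) * I := by
    rw [ht]; push_cast; ring
  rw [hz]
  have hNpos : 0 < (|(n : ℝ)| + 1) := by positivity
  have hpow_nonneg : 0 ≤ (|(n : ℝ)| + 1) ^ (-α) := Real.rpow_nonneg hNpos.le _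
  -- it suffices to bound by either summand of `C`
  have hsplit : ∀ x : ℝ, (x ≤ A * max C₁ 0 * c ^ (-α) * (2 : ℝ) ^ α * (|(n : ℝ)| + 1) ^ (-α) ∨
      x ≤ max B 0 * (2 * m / c + 1) ^ α * (|(n : ℝ)| + 1) ^ (-α)) →
      x ≤ C * (|(n : ℝ)| + 1) ^ (-α) := by
    intro x hx
    have e : C * (|(n : ℝ)| + 1) ^ (-α) = A * max C₁ 0 * c ^ (-α) * (2 : ℝ) ^ α * (|(n : ℝ)| + 1) ^ (-α)
        + max B 0 * (2 * m / c + 1) ^ α * (|(n : ℝ)| + 1) ^ (-α) := by rw [hCdef]; ring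
    rw [e]
    rcases hx with h | h
    · exact h.trans (le_add_of_nonneg_right (mul_nonneg hT2 hpow_nonneg))
    · exact h.trans (le_add_of_nonneg_left (mul_nonneg hT1 hpow_nonneg))
  by_cases hbig : 2 * (m : ℝ) ≤ |t|
  · -- Lemma 4.6 (i)
    apply hsplit
    left
    have h1 : ‖phiFactor m k (t * I)‖ ≤ max C₁ 0 * |t| ^ (-α) :=
      (hC₁ t hbig).trans (mul_le_mul_of_nonneg_right (le_max_left _ _) (Real.rpow_nonneg (abs_nonneg _) _))
    -- `|t|^{-α} = c^{-α} |n|^{-α} ≤ c^{-α} 2^α (|n|+1)^{-α}`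
    have h2n : (|(n : ℝ)| + 1) ≤ 2 * |(n : ℝ)| := by linarith
    have hA' : (2 * |(n : ℝ)|) ^ (-α) ≤ (|(n : ℝ)| + 1) ^ (-α) :=
      Real.rpow_le_rpow_of_nonpos hNpos h2n (by linarith)
    rw [Real.mul_rpow (by norm_num) (abs_nonneg _)] at hA'
    have h22 : (2 : ℝ) ^ α * (2 : ℝ) ^ (-α) = 1 := by
      rw [← Real.rpow_add (by norm_num)]; norm_num
    have hpow : |t| ^ (-α) ≤ c ^ (-α) * (2 : ℝ) ^ α * (|(n : ℝ)| + 1) ^ (-α) := by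
      rw [htabs, Real.mul_rpow hcpos.le (abs_nonneg _), mul_assoc]
      refine mul_le_mul_of_nonneg_left ?_ (Real.rpow_nonneg hcpos.le _)
      calc |(n : ℝ)| ^ (-α) = (2 : ℝ) ^ α * ((2 : ℝ) ^ (-α) * |(n : ℝ)| ^ (-α)) := by
            rw [← mul_assoc, h22, one_mul]
        _ ≤ (2 : ℝ) ^ α * (|(n : ℝ)| + 1) ^ (-α) :=
            mul_le_mul_of_nonneg_left hA' (Real.rpow_nonneg (by norm_num) _)
    rw [norm_rhoFactor_mul_I hm k t]
    calc (π / (m : ℝ)) ^ (1 / (2 * (m : ℝ))) * ‖phiFactor m k (t * I)‖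
        ≤ A * (max C₁ 0 * |t| ^ (-α)) := by
          rw [← hα, ← hA]; exact mul_le_mul_of_nonneg_left h1 hApos.le
      _ ≤ A * (max C₁ 0 * (c ^ (-α) * (2 : ℝ) ^ α * (|(n : ℝ)| + 1) ^ (-α))) :=
          mul_le_mul_of_nonneg_left (mul_le_mul_of_nonneg_left hpow (le_max_right _ _)) hApos.le
      _ = A * max C₁ 0 * c ^ (-α) * (2 : ℝ) ^ α * (|(n : ℝ)| + 1) ^ (-α) := by ring
  · -- the compact range `c ≤ |t| ≤ 2m`
    apply hsplit
    right
    push Not at hbig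
    have htK : t ∈ K := by
      rcases le_or_gt 0 t with h0 | h0
      · right
        rw [abs_of_nonneg h0] at htc hbig
        exact ⟨htc, hbig.le⟩
      · left
        rw [abs_of_neg h0] at htc hbig
        exact ⟨by linarith, by linarith⟩
    have h1 : ‖rhoFactor m k (t * I)‖ ≤ max B 0 := (hB t htK).trans (le_max_left _ _)
    -- `1 ≤ (2m/c + 1)^α (|n|+1)^{-α}` since `|n| + 1 ≤ 2m/c + 1`
    have hn_le : |(n : ℝ)| + 1 ≤ 2 * m / c + 1 := by
      have : |(n : ℝ)| ≤ 2 * m / c := by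
        rw [le_div_iff₀ hcpos, mul_comm, ← htabs]; exact hbig.le
      linarith
    have hMpos : 0 < 2 * (m : ℝ) / c + 1 := by positivity
    have hone : 1 ≤ (2 * m / c + 1) ^ α * (|(n : ℝ)| + 1) ^ (-α) := by
      have h3 : (2 * (m : ℝ) / c + 1) ^ (-α) ≤ (|(n : ℝ)| + 1) ^ (-α) :=
        Real.rpow_le_rpow_of_nonpos hNpos hn_le (by linarith)
      have h4 : (2 * (m : ℝ) / c + 1) ^ α * (2 * (m : ℝ) / c + 1) ^ (-α) = 1 := by
        rw [← Real.rpow_add hMpos]; simp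
      calc (1 : ℝ) = (2 * (m : ℝ) / c + 1) ^ α * (2 * (m : ℝ) / c + 1) ^ (-α) := h4.symm
        _ ≤ (2 * m / c + 1) ^ α * (|(n : ℝ)| + 1) ^ (-α) :=
            mul_le_mul_of_nonneg_left h3 (Real.rpow_nonneg hMpos.le _)
    calc ‖rhoFactor m k (t * I)‖ ≤ max B 0 * 1 := by rw [mul_one]; exact h1
      _ ≤ max B 0 * ((2 * m / c + 1) ^ α * (|(n : ℝ)| + 1) ^ (-α)) :=
          mul_le_mul_of_nonneg_left hone (le_max_right _ _)
      _ = max B 0 * (2 * m / c + 1) ^ α * (|(n : ℝ)| + 1) ^ (-α) := by ring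

/-- RH-FREE. **The diagonal operator `D^{(m,k)}` of the proof of Theorem 4.8** («Theorem 4.4 (and its proof)
apply with `ρ_∞^{(m,k)}` in place of `ρ_∞`»: in eq. (4.4) the diagonal becomes `Dδ_0 = 0`,
`Dδ_n = ρ_∞^{(m,k)}(2πin/log p)δ_n`, and «the decay … is `O(|n|^{−1/2m})` … Thus `D` is an infinitesimal of
order» `1/(2m)`): for `m ≥ 1`, any `k`, `p > 1` there is a bounded operator `D` on `ℓ²(ℤ)`, diagonal in the
basis `δ_n`, with these entries, which is an infinitesimal of order `1/(2m)` (t17's `exists_lpDiagonal`,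
`isInfinitesimalOfOrder_of_diag`; decay `exists_norm_rhoFactor_primePole_le`).
[cite: ConnesConsani2021QuasiInner, §4.4 proof of Thm 4.8 (arXiv chunk p0014:L64) with Thm 4.4 (ii) eq. (4.4) (p0011:L98) and its proof (p0012:L19–L21)] -/
theorem exists_diag_rhoFactor_primePole {m : ℕ} (hm : 0 < m) (k : ℕ) {p : ℕ} (hp : 1 < p) :
    ∃ Dop : lp (fun _ : ℤ => ℂ) 2 →L[ℂ] lp (fun _ : ℤ => ℂ) 2,
      Dop (lp.single 2 0 (1 : ℂ)) = 0 ∧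
        (∀ n : ℤ, n ≠ 0 →
          Dop (lp.single 2 n (1 : ℂ)) =
            rhoFactor m k (2 * π * I * n / Real.log p) • lp.single 2 n (1 : ℂ)) ∧
          (∀ n : ℤ, Dop (lp.single 2 n (1 : ℂ)) =
            (if n = 0 then (0 : ℂ) else rhoFactor m k (2 * π * I * n / Real.log p)) •
              lp.single 2 n (1 : ℂ)) ∧
            IsInfinitesimalOfOrder Dop (1 / (2 * (m : ℝ))) := by
  have hα : (0 : ℝ) ≤ 1 / (2 * (m : ℝ)) := by positivity
  obtain ⟨C₁, hC₁⟩ := exists_norm_rhoFactor_primePole_le hm k hp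
  set d : ℤ → ℂ := fun n => if n = 0 then 0 else rhoFactor m k (2 * π * I * n / Real.log p) with hd
  have hd' : ∀ n : ℤ, ‖d n‖ ≤ max C₁ 0 * ((|n| : ℝ) + 1) ^ (-(1 / (2 * (m : ℝ)))) := by
    intro n
    by_cases hn : n = 0
    · have h0 : d n = 0 := by rw [hd]; simp only [hn, if_true]
      rw [h0, norm_zero]
      exact mul_nonneg (le_max_right _ _) (Real.rpow_nonneg (by positivity) _)
    · have h1 : d n = rhoFactor m k (2 * π * I * n / Real.log p) := by rw [hd]; simp only [hn, if_false]
      rw [h1]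
      exact (hC₁ n hn).trans
        (mul_le_mul_of_nonneg_right (le_max_left _ _) (Real.rpow_nonneg (by positivity) _))
  have hdb : ∀ n : ℤ, ‖d n‖ ≤ max C₁ 0 := by
    intro n
    refine (hd' n).trans (mul_le_of_le_one_right (le_max_right _ _) ?_)
    exact Real.rpow_le_one_of_one_le_of_nonpos (by linarith [abs_nonneg (n : ℝ)])
      (by linarith)
  obtain ⟨Dop, hDop⟩ := exists_lpDiagonal hdb
  refine ⟨Dop, ?_, ?_, fun n => hDop n, isInfinitesimalOfOrder_of_diag hDop hα hd'⟩
  · have h0 : d 0 = 0 := by rw [hd]; simp only [if_true]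
    rw [hDop, h0, zero_smul]
  · intro n hn
    have h1 : d n = rhoFactor m k (2 * π * I * n / Real.log p) := by rw [hd]; simp only [hn, if_false]
    rw [hDop, h1]

end Decay

end QuasiInner

end Literature.NumberTheory.ConnesConsani2021

end
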